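import Summits.MatrixMultiplication.MatrixMultiplication.Theorems.SoloInformedValFamilyBudget

/-!
# Four-set packing and the packing–deficit inequality in exponent two

Solo-informed MatrixMultiplication, gen 85–86 (dossier `paper/val-superlinear.md` §15.8 (n)(xxiii); CLAIMS c642, c646,
c647).

Setting of `SoloInformedValFamilyCriterion` / `SoloInformedValFamilyBudget`: an abelian group `G`, identity
potentials, a family `(X_t × Y_t × Z_t)_{t ∈ T}` of complete blocks with pairwise disjoint `Y`-classes and pairwise
disjoint `Z`-classes; `M_a = X_a + Y_a − Z_a`, `U_a = X_a + ⋃_{b ≠ a} (Y_b − Z_b)` (`crossU`),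
`V_a = Y_a + ⋃_{c ≠ a} (X_c − Z_c)` (`crossV`), and the MIRRORED set
`Ṽ_a = Z_a + ⋃_{c ≠ a} (X_c − Y_c)`, which is `crossV T X Z Y a` (the `V`-set of the family with the roles of the
`Y`- and `Z`-classes exchanged).

In a group of EXPONENT TWO (`∀ g, g + g = 0`, e.g. `G = 𝔽₂^m`) the mirrored mixed image `X_a + Z_a − Y_a` IS `M_a`
and the mirrored `U`-set IS `U_a` (`mixedImage_swap_of_exponent_two`, `crossU_swap_of_exponent_two`), so the family
criterion of the mirrored family (`NoAccidental.swapYZ`) gives `M_a ⊥ Ṽ_a` and `U_a ⊥ Ṽ_a`; and `V_a ⊥ Ṽ_a` holds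
because a common element `y + (x_c − z_c) = z + (x' − y')` is an accidental solution of pattern `(c', a, c)`
(`NoAccidental.disjoint_crossV_crossVt`).  Hence the

* FOUR-SET PACKING `NoAccidental.fourSet_card_le`: `|X_a||Y_a||Z_a| + |U_a| + |V_a| + |Ṽ_a| ≤ |G|`, and, with the
  difference-set lower bounds of `SoloInformedValFamilyBudget` (`|U_a| ≥ Σ_{b ≠ a} |Y_b||Z_b|`,
  `|V_a| ≥ Σ_{c ≠ a} |X_c||Z_c|`, `|Ṽ_a| ≥ Σ_{c ≠ a} |X_c||Y_c|`), the
* PACKING–DEFICIT INEQUALITY `NoAccidental.packing_deficit`: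
  `|X_a||Y_a||Z_a| + Σ_{b ≠ a} (|Y_b||Z_b| + |X_b||Z_b| + |X_b||Y_b|) ≤ |G|` for every block `a`.

For PURE `𝔽₂` designs (`Y_t`, `Z_t` cosets of subspaces of dimensions `η_t`, `ζ_t`, `x_t` rows) this reads
`2^m ≥ x_a 2^{η_a + ζ_a} + Σ_{b ≠ a} [2^{η_b + ζ_b} + x_b (2^{η_b} + 2^{ζ_b})]`, which proves the uniform volume bound
`Σ_t x_t 2^{η_t + ζ_t} ≤ 2^m` for all pure designs with `m ≤ 6` (dossier (PT); the deficit
`2^{ρ} + x (2^{η} + 2^{ζ}) − x 2^{ρ}` is non-negative for every admissible block type when `m ≤ 6`).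
Elementary; no `sorry`.
-/

namespace Summit.MatrixMultiplication.MatrixMultiplication.Theorems.SoloVal

open Finset

section FourSet

variable {G : Type*} [AddCommGroup G] [DecidableEq G]
variable {ι : Type*} [DecidableEq ι]
variable {T : Finset ι} {X Y Z : ι → Finset G} {a : ι}

omit [DecidableEq G] in
/-- In a group of exponent two, subtraction is addition. -/
theorem sub_eq_add_of_exponent_two (h2 : ∀ g : G, g + g = 0) (x y : G) : x - y = x + y := by
  rw [sub_eq_add_neg, neg_eq_of_add_eq_zero_left (h2 y)]

/-- In exponent two, difference sets are symmetric: `A − B = B − A`. -/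
theorem diffSet_comm_of_exponent_two (h2 : ∀ g : G, g + g = 0) (A B : Finset G) :
    diffSet A B = diffSet B A := by
  ext g
  simp only [mem_diffSet, sub_eq_add_of_exponent_two h2]
  constructor
  · rintro ⟨u, hu, v, hv, rfl⟩
    exact ⟨v, hv, u, hu, add_comm v u⟩
  · rintro ⟨v, hv, u, hu, rfl⟩
    exact ⟨u, hu, v, hv, add_comm u v⟩

/-- In exponent two the mirrored mixed image is the mixed image: `X + Z − Y = X + Y − Z`. -/
theorem mixedImage_swap_of_exponent_two (h2 : ∀ g : G, g + g = 0) (X₀ Y₀ Z₀ : Finset G) :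
    mixedImage X₀ Z₀ Y₀ = mixedImage X₀ Y₀ Z₀ := by
  ext g
  simp only [mem_mixedImage, sub_eq_add_of_exponent_two h2]
  constructor
  · rintro ⟨x, hx, z, hz, y, hy, rfl⟩
    exact ⟨x, hx, y, hy, z, hz, by abel⟩
  · rintro ⟨x, hx, y, hy, z, hz, rfl⟩
    exact ⟨x, hx, z, hz, y, hy, by abel⟩

/-- In exponent two the `U`-set of the mirrored family (roles of `Y` and `Z` exchanged) is `U_a` itself. -/
theorem crossU_swap_of_exponent_two (h2 : ∀ g : G, g + g = 0) :
    crossU T X Z Y a = crossU T X Y Z a := by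
  unfold crossU
  congr 1
  exact Finset.biUnion_congr rfl fun b _ => diffSet_comm_of_exponent_two h2 (Z b) (Y b)

/-- `M_a ⊥ Ṽ_a` in exponent two (`Ṽ_a = Z_a + ⋃_{c ≠ a} (X_c − Y_c) = crossV T X Z Y a`): the family criterion of the
mirrored family, whose mixed image is `M_a`. -/
theorem NoAccidental.disjoint_mixedImage_crossVt (h2 : ∀ g : G, g + g = 0)
    (hY : ∀ a ∈ T, ∀ b ∈ T, a ≠ b → Disjoint (Y a) (Y b))
    (hZ : ∀ a ∈ T, ∀ b ∈ T, a ≠ b → Disjoint (Z a) (Z b))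
    (hN : NoAccidental (id : G → G) id id (famPairs T X Y) (famPairs T Y Z) (famPairs T Z X))
    (ha : a ∈ T) :
    Disjoint (mixedImage (X a) (Y a) (Z a)) (crossV T X Z Y a) := by
  obtain ⟨-, -, hMV, -⟩ :=
    familyCriterion_of_noAccidental (X := X) (Y := Z) (Z := Y) hZ hY (NoAccidental.swapYZ hN) ha
  rwa [mixedImage_swap_of_exponent_two h2] at hMV

/-- `U_a ⊥ Ṽ_a` in exponent two: the family criterion of the mirrored family, whose `U`-set is `U_a`. -/
theorem NoAccidental.disjoint_crossU_crossVt (h2 : ∀ g : G, g + g = 0)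
    (hY : ∀ a ∈ T, ∀ b ∈ T, a ≠ b → Disjoint (Y a) (Y b))
    (hZ : ∀ a ∈ T, ∀ b ∈ T, a ≠ b → Disjoint (Z a) (Z b))
    (hN : NoAccidental (id : G → G) id id (famPairs T X Y) (famPairs T Y Z) (famPairs T Z X))
    (ha : a ∈ T) :
    Disjoint (crossU T X Y Z a) (crossV T X Z Y a) := by
  obtain ⟨-, -, -, hUV⟩ :=
    familyCriterion_of_noAccidental (X := X) (Y := Z) (Z := Y) hZ hY (NoAccidental.swapYZ hN) ha
  rwa [crossU_swap_of_exponent_two h2] at hUV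

/-- `V_a ⊥ Ṽ_a` in exponent two: a common element `y + (x − z) = z' + (x' − y')` with `(x, z)` from a block `c ≠ a`,
`(x', y')` from a block `c' ≠ a`, `y ∈ Y_a`, `z' ∈ Z_a` is an accidental solution of pattern `(c', a, c)`, which forces
`y' = y ∈ Y_a ∩ Y_{c'}`, contradicting the disjointness of the `Y`-classes. -/
theorem NoAccidental.disjoint_crossV_crossVt (h2 : ∀ g : G, g + g = 0)
    (hY : ∀ a ∈ T, ∀ b ∈ T, a ≠ b → Disjoint (Y a) (Y b))
    (hN : NoAccidental (id : G → G) id id (famPairs T X Y) (famPairs T Y Z) (famPairs T Z X))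
    (ha : a ∈ T) :
    Disjoint (crossV T X Y Z a) (crossV T X Z Y a) := by
  rw [Finset.disjoint_left]
  intro g hgV hgVt
  obtain ⟨y, hy, c, hc, x, hx, z, hz, hgy⟩ := mem_crossV.mp hgV
  obtain ⟨z', hz', c', hc', x', hx', y', hy', hgz⟩ := mem_crossV.mp hgVt
  obtain ⟨hc'a, hc'T⟩ := Finset.mem_erase.mp hc'
  obtain ⟨-, hcT⟩ := Finset.mem_erase.mp hc
  have hgy' : y + (x + z) = g := by rw [← sub_eq_add_of_exponent_two h2 x z]; exact hgy
  have hgz' : z' + (x' + y') = g := by rw [← sub_eq_add_of_exponent_two h2 x' y']; exact hgz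
  have h0 : (id x' - id y') + (id y - id z') + (id z - id x) = (0 : G) := by
    simp only [id]
    rw [sub_eq_add_of_exponent_two h2 x' y', sub_eq_add_of_exponent_two h2 y z',
      sub_eq_add_of_exponent_two h2 z x]
    calc x' + y' + (y + z') + (z + x) = (z' + (x' + y')) + (y + (x + z)) := by abel
      _ = g + g := by rw [hgz', hgy']
      _ = 0 := h2 g
  obtain ⟨-, hyy, -⟩ := hN x' y' y z' z x (mem_famPairs.mpr ⟨c', hc'T, hx', hy'⟩)
    (mem_famPairs.mpr ⟨a, ha, hy, hz'⟩) (mem_famPairs.mpr ⟨c, hcT, hz, hx⟩) h0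
  exact Finset.disjoint_left.mp (hY a ha c' hc'T (Ne.symm hc'a)) hy (by rw [← hyy]; exact hy')

/-- FOUR-SET PACKING in exponent two: for an accidental-free family with pairwise disjoint `Y`- and `Z`-classes,
`|X_a||Y_a||Z_a| + |U_a| + |V_a| + |Ṽ_a| ≤ |G|` at every block `a` (the four sets `M_a, U_a, V_a, Ṽ_a` are pairwise
disjoint). -/
theorem NoAccidental.fourSet_card_le [Fintype G] (h2 : ∀ g : G, g + g = 0)
    (hY : ∀ a ∈ T, ∀ b ∈ T, a ≠ b → Disjoint (Y a) (Y b))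
    (hZ : ∀ a ∈ T, ∀ b ∈ T, a ≠ b → Disjoint (Z a) (Z b))
    (hN : NoAccidental (id : G → G) id id (famPairs T X Y) (famPairs T Y Z) (famPairs T Z X))
    (ha : a ∈ T) :
    (X a).card * (Y a).card * (Z a).card + (crossU T X Y Z a).card + (crossV T X Y Z a).card +
      (crossV T X Z Y a).card ≤ Fintype.card G := by
  obtain ⟨hT, hMU, hMV, hUV⟩ := familyCriterion_of_noAccidental hY hZ hN ha
  have hMVt := NoAccidental.disjoint_mixedImage_crossVt h2 hY hZ hN ha
  have hUVt := NoAccidental.disjoint_crossU_crossVt h2 hY hZ hN ha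
  have hVVt := NoAccidental.disjoint_crossV_crossVt h2 hY hN ha
  rw [← hT.card_mixedImage, ← Finset.card_union_of_disjoint hMU,
    ← Finset.card_union_of_disjoint (Finset.disjoint_union_left.mpr ⟨hMV, hUV⟩),
    ← Finset.card_union_of_disjoint
      (Finset.disjoint_union_left.mpr ⟨Finset.disjoint_union_left.mpr ⟨hMVt, hUVt⟩, hVVt⟩)]
  exact Finset.card_le_univ _

/-- The mirrored `KI`-budget: `Σ_{c ≠ a} |X_c||Y_c| ≤ |Ṽ_a|` (the `X_c − Y_c`, `c ≠ a`, are pairwise disjoint,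
uniquely represented, and `Ṽ_a` contains a translate of their union). No exponent hypothesis is needed here. -/
theorem NoAccidental.sum_card_mul_card_le_card_crossVt
    (hY : ∀ a ∈ T, ∀ b ∈ T, a ≠ b → Disjoint (Y a) (Y b))
    (hZ : ∀ a ∈ T, ∀ b ∈ T, a ≠ b → Disjoint (Z a) (Z b))
    (hZne : ∀ c ∈ T, (Z c).Nonempty)
    (hN : NoAccidental (id : G → G) id id (famPairs T X Y) (famPairs T Y Z) (famPairs T Z X))
    (ha : a ∈ T) :
    ∑ c ∈ T.erase a, (X c).card * (Y c).card ≤ (crossV T X Z Y a).card :=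
  card_crossV_ge (X := X) (Y := Z) (Z := Y)
    (fun _ hc => familyCriterion_of_noAccidental hZ hY (NoAccidental.swapYZ hN) hc) hZne ha

/-- THE PACKING–DEFICIT INEQUALITY: in exponent two, every block `a` of an accidental-free family of complete
blocks with pairwise disjoint, nonempty classes satisfies
`|X_a||Y_a||Z_a| + Σ_{b ≠ a} |Y_b||Z_b| + Σ_{c ≠ a} |X_c||Z_c| + Σ_{c ≠ a} |X_c||Y_c| ≤ |G|`. -/
theorem NoAccidental.packing_deficit [Fintype G] (h2 : ∀ g : G, g + g = 0)
    (hY : ∀ a ∈ T, ∀ b ∈ T, a ≠ b → Disjoint (Y a) (Y b))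
    (hZ : ∀ a ∈ T, ∀ b ∈ T, a ≠ b → Disjoint (Z a) (Z b))
    (hXne : ∀ c ∈ T, (X c).Nonempty) (hYne : ∀ c ∈ T, (Y c).Nonempty)
    (hZne : ∀ c ∈ T, (Z c).Nonempty)
    (hN : NoAccidental (id : G → G) id id (famPairs T X Y) (famPairs T Y Z) (famPairs T Z X))
    (ha : a ∈ T) :
    (X a).card * (Y a).card * (Z a).card + ∑ b ∈ T.erase a, (Y b).card * (Z b).card +
      ∑ c ∈ T.erase a, (X c).card * (Z c).card + ∑ c ∈ T.erase a, (X c).card * (Y c).card ≤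
        Fintype.card G := by
  have hcrit : ∀ c ∈ T, FamilyCriterionAt T X Y Z c :=
    fun c hc => familyCriterion_of_noAccidental hY hZ hN hc
  have h₁ := card_crossU_ge hcrit hXne ha
  have h₂ := card_crossV_ge hcrit hYne ha
  have h₃ := NoAccidental.sum_card_mul_card_le_card_crossVt hY hZ hZne hN ha
  have h₄ := NoAccidental.fourSet_card_le h2 hY hZ hN ha
  omega

/-- The packing–deficit inequality in DEFICIT FORM: writing `v_t = |X_t||Y_t||Z_t|`, every block `a` satisfies
`Σ_{t ∈ T} v_t + Σ_{b ≠ a} (|Y_b||Z_b| + |X_b||Z_b| + |X_b||Y_b|) ≤ |G| + Σ_{b ≠ a} v_b`, i.e. the total volume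
is at most `|G|` minus the sum of the other blocks' deficits `|Y_b||Z_b| + |X_b||Z_b| + |X_b||Y_b| − v_b`. -/
theorem NoAccidental.sum_volume_le_of_packing_deficit [Fintype G] (h2 : ∀ g : G, g + g = 0)
    (hY : ∀ a ∈ T, ∀ b ∈ T, a ≠ b → Disjoint (Y a) (Y b))
    (hZ : ∀ a ∈ T, ∀ b ∈ T, a ≠ b → Disjoint (Z a) (Z b))
    (hXne : ∀ c ∈ T, (X c).Nonempty) (hYne : ∀ c ∈ T, (Y c).Nonempty)
    (hZne : ∀ c ∈ T, (Z c).Nonempty)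
    (hN : NoAccidental (id : G → G) id id (famPairs T X Y) (famPairs T Y Z) (famPairs T Z X))
    (ha : a ∈ T) :
    ∑ t ∈ T, (X t).card * (Y t).card * (Z t).card +
      ∑ b ∈ T.erase a, ((Y b).card * (Z b).card + (X b).card * (Z b).card + (X b).card * (Y b).card) ≤
        Fintype.card G + ∑ b ∈ T.erase a, (X b).card * (Y b).card * (Z b).card := by
  have h := NoAccidental.packing_deficit h2 hY hZ hXne hYne hZne hN ha
  rw [← Finset.add_sum_erase T (fun t => (X t).card * (Y t).card * (Z t).card) ha,
    Finset.sum_add_distrib, Finset.sum_add_distrib]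
  omega

end FourSet

end Summit.MatrixMultiplication.MatrixMultiplication.Theorems.SoloVal
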